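import Literature.Analysis.FluidPDE.LerayHopfMild
import Literature.Analysis.FluidPDE.SolenoidalTruncation
import Literature.Analysis.UnboundedOperators.HeatFlowCalculus

/-!
# Leray–Hopf weak solutions are mild: the duality identity for `H¹_σ` test fields

Analysis/FluidPDE support file. It serves the discharge of the named fact
`Literature.Analysis.FluidPDE.tao2011_duhamelNonlinearSpeed_unit` (`TaoBoundedTotalSpeed.lean`: the
nonlinear part of Tao 2011, Prop. 9.1, *bounded total speed*, arXiv:1108.1165, §9), whose proof
evaluates the Duhamel formula of a finite energy classical solution pointwise by testing it against
the divergence-free fields `P(g e)` (`g` a bump, `e` a direction, `P` the Leray projector). These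
test fields are smooth and square integrable with square-integrable gradient, but they are **not
compactly supported** (they decay like `|x|⁻³`), so the tree's duality identity
`IsLerayHopfOn.integral_inner_eq_mild` (`LerayHopfMild.lean`, tests in `C_{c,σ}^∞`) does not apply
to them directly. This file extends that identity to the whole class `H¹_σ`.

**Main result** (`IsLerayHopfOn.integral_inner_eq_mild_of_hasWeakGradient`, proved). Let `E` be a
real inner product space of dimension `3`, `0 < ν`, `0 < T`, `u₀ ∈ L²(E; E)`, `u` a Leray–Hopf weak
solution of the unforced Navier–Stokes system on `E × [0, T)` with datum `u₀`
(`Fluid.IsLerayHopfOn T ν 0 u₀ u`), and let `φ ∈ L²(E; E)` be weakly divergence free with a weak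
gradient `G`, `∫ |G|² < ∞`. Then for every `t ∈ (0, T]`,

  `⟨u(t), φ⟩ = ⟨u₀, e^{νtΔ}φ⟩ + ∫_{(0,t]} ⟨u(τ), (u(τ)·∇) e^{ν(t-τ)Δ}φ⟩ dτ`

(Fabes–Jones–Rivière 1972, Thm. 2.1; Lemarié-Rieusset 2016, Prop. 6.5 with Thm. 6.1, where the
integral equation is stated against all sufficiently decaying divergence-free tests).

## Proof

By the density of `C_{c,σ}^∞` in `H¹_σ` (tree: `Fluid.exists_isDivFree_test_approx`,
`SolenoidalTruncation.lean`) choose divergence-free test fields `Φₙ` with `‖Φₙ - φ‖₂ ≤ 1/(n+1)` and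
`∫ |DΦₙ - G|² ≤ 1/(n+1)`, apply the compactly supported identity to each `Φₙ` and pass to the
limit in its three terms:
* `⟨u(t), Φₙ⟩ → ⟨u(t), φ⟩` and `⟨u₀, e^{νtΔ}Φₙ⟩ → ⟨u₀, e^{νtΔ}φ⟩` by Cauchy–Schwarz and the `L²`
  contraction of the heat flow;
* for the nonlinear term, at a.e. `τ ∈ (0, t)` the slice `u(τ)` lies in `L⁴` and
  `|∫⟨u, ((A₁ - A₂)·)u⟩| ≤ ‖A₁ - A₂‖_{L²_F} ‖u(τ)‖₄²` (`lintegral_enorm_inner_apply_le`), where the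
  difference of the caloric gradients is `D(e^{sΔ}Φₙ) - D(e^{sΔ}φ) = e^{sΔ}(DΦₙ - G)` — the
  derivative falls on the data, classically for `Φₙ` and **weakly for `φ`**
  (`HasWeakGradient.fderiv_heatExtension_apply`: differentiate under the integral and integrate by
  parts with the weak gradient against the Gaussian weight, via the tree's cut-off extension
  `HasWeakGradient.integral_inner_fderiv_apply_of_memLp`) — so that
  `‖D(e^{sΔ}Φₙ) - D(e^{sΔ}φ)‖²_{L²_F} ≤ ∫|DΦₙ - G|² ≤ 1/(n+1)`
  (`lintegral_frobeniusNormSq_fderiv_heatExtension_sub_le`), and `∫₀ᵀ ‖u‖₄² < ∞`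
  (`IsLerayHopfOn.lintegral_eLpNorm_four_sq_lt_top`) gives the convergence of the time integrals;
  the limit integrand is measurable as an a.e. limit and integrable by the same bound.

## Contents

* `heatExtension_sub_of_memLp`, `continuous_fderiv_heatExtension_of_memLp`: small calculus facts
  for the caloric extension on `Lᵖ`;
* `HasWeakGradient.fderiv_heatExtension_apply`: `∂ᵥ(e^{tΔ}φ) = e^{tΔ}(G v)` for `φ ∈ L²` with weak
  gradient `G`, `G v ∈ L²`;
* `lintegral_frobeniusNormSq_fderiv_heatExtension_sub_le`: Frobenius `L²` control of the caloric
  gradients by the data;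
* `continuous_uncurry_fderiv_heatTest`: joint continuity of `(σ, x) ↦ D(e^{νσΔ}Φ)(x)` for a test
  field `Φ`;
* `IsLerayHopfOn.integral_inner_eq_mild_of_hasWeakGradient`: the main result.

## Mathlib / tree search

Mathlib (this pin) has no heat semigroup on functions and no weak/mild Navier–Stokes theory; used
from Mathlib: `MeasureTheory.Measure.measurePreserving_sub_left`, `integral_inner`,
`ext_inner_left`, `aestronglyMeasurable_of_tendsto_ae`, `AEStronglyMeasurable.integral_prod_right'`,
`continuous_clm_apply`. Tree (`lean search 'integral_inner_eq_mild|fderiv_heatExtension|isDivFree_test_approx' --decl`):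
the compactly supported identity `IsLerayHopfOn.integral_inner_eq_mild` and its toolkit
(`LerayHopfMild`, `LerayHopfH1Test`: `lintegral_enorm_inner_apply_le`,
`integrable_inner_apply_of_holder`, `tendsto_of_enorm_sub_le`), the heat-flow calculus
(`UnboundedOperators/HeatFlowCalculus`: `fderiv_heatExtension_apply_eq_integral`,
`fderiv_heatExtension_apply_eq_heatExtension_fderiv` — the `C¹` case of the commutation, whose
proof is followed here —, `memLp_fderiv_heatKernel_apply`, `integrable_temperate_mul_heatKernel_smul`),
and the density theorem `exists_isDivFree_test_approx` (`SolenoidalTruncation`); no prior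
`H¹_σ` form of the duality identity.

## References

* E. B. Fabes, B. F. Jones, N. M. Rivière, *The initial value problem for the Navier–Stokes
  equations with data in `L^p`*, Arch. Rational Mech. Anal. 45 (1972), 222–240, Thm. 2.1
  (`FabesJonesRiviere1972`).
* P. G. Lemarié-Rieusset, *The Navier–Stokes problem in the 21st century*, CRC Press (2016),
  Prop. 6.5, Thm. 6.1, §6.2 (`LemarieRieusset2016`).
* T. Tao, *Localisation and compactness properties of the Navier–Stokes global regularity
  problem*, Anal. PDE 6 (2013) 25–107 = arXiv:1108.1165, §9, proof of Prop. 9.1 ((9.2): the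
  Duhamel formula for finite energy almost smooth solutions) (`Tao2011`).
-/

noncomputable section

open MeasureTheory TopologicalSpace Set Function Filter Topology InnerProductSpace
open scoped RealInnerProductSpace ENNReal NNReal ContDiff

namespace Literature.Analysis.FluidPDE

open UnboundedOperators

variable {E : Type*} [NormedAddCommGroup E] [InnerProductSpace ℝ E] [FiniteDimensional ℝ E]
  [MeasurableSpace E] [BorelSpace E]

/-! ### The caloric extension of an `H¹` field: the derivative falls on the weak gradient -/

section HeatWeak

variable {F' : Type*} [NormedAddCommGroup F'] [InnerProductSpace ℝ F'] [FiniteDimensional ℝ F']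

/-- **Linearity of the caloric extension on `Lᵖ`**, pointwise: for `f, g ∈ Lᵖ`, `1 ≤ p`,
`0 < t`, `e^{tΔ}(f - g)(x) = e^{tΔ}f(x) - e^{tΔ}g(x)` (both convolution integrals converge
absolutely at every point). [folklore] -/
theorem heatExtension_sub_of_memLp {F : Type*} [NormedAddCommGroup F] [NormedSpace ℝ F]
    {f g : E → F} {p : ℝ≥0∞} (hf : MemLp f p volume) (hg : MemLp g p volume) (hp : 1 ≤ p)
    {t : ℝ} (ht : 0 < t) (x : E) :
    heatExtension (f - g) t x = heatExtension f t x - heatExtension g t x := by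
  simp only [heatExtension_eq_integral_sub]
  have hi : ∀ {h : E → F}, MemLp h p volume →
      Integrable (fun y => heatKernel t (x - y) • h y) := by
    intro h hh
    simpa using integrable_temperate_mul_heatKernel_smul ht hh hp
      (Function.HasTemperateGrowth.const 1) x
  rw [← integral_sub (hi hf) (hi hg)]
  exact integral_congr_ae (Eventually.of_forall fun y => by simp [smul_sub])

/-- **The derivative of the caloric extension of an `H¹` field is the caloric extension of its
weak gradient**: if `G` is a weak gradient of `φ ∈ L²(E; F')` with `G v ∈ L²`, then for `0 < t`
and every `x`, `∂ᵥ(e^{tΔ}φ)(x) = e^{tΔ}(G v)(x)`. Proof: differentiate under the integral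
(`fderiv_heatExtension_apply_eq_integral`) and integrate by parts with the weak gradient against
the smooth `L²` weight `y ↦ G_t(x - y)` (`HasWeakGradient.integral_inner_fderiv_apply_of_memLp`,
tested against `G_t(x - ·) • e` for every `e`). The `C¹` case is the tree's
`fderiv_heatExtension_apply_eq_heatExtension_fderiv`. [folklore] -/
theorem HasWeakGradient.fderiv_heatExtension_apply {φ : E → F'} {G : E → E →L[ℝ] F'}
    (hG : HasWeakGradient φ G) (hφ2 : MemLp φ 2 volume) (v : E)
    (hGv : MemLp (fun x => G x v) 2 volume) {t : ℝ} (ht : 0 < t) (x : E) :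
    fderiv ℝ (heatExtension φ t) x v = heatExtension (fun z => G z v) t x := by
  rw [fderiv_heatExtension_apply_eq_integral ht hφ2 one_le_two x v, heatExtension_eq_integral_sub]
  -- the reflected kernel `k y = G_t(x - y)` and its derivative
  set k : E → ℝ := fun y => heatKernel t (x - y) with hk
  have hkd : ∀ y, HasFDerivAt k ((fderiv ℝ (heatKernel t) (x - y)).comp
      (-ContinuousLinearMap.id ℝ E)) y := by
    intro y
    have h1 : HasFDerivAt (fun y : E => x - y) (-ContinuousLinearMap.id ℝ E) y :=
      (hasFDerivAt_id y).const_sub x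
    have h2 := (hasFDerivAt_heatKernel t (x - y)).comp y h1
    rw [← (hasFDerivAt_heatKernel t (x - y)).fderiv] at h2
    exact h2
  have hk' : ∀ y, fderiv ℝ k y v = -fderiv ℝ (heatKernel t) (x - y) v := fun y => by
    rw [(hkd y).fderiv]
    simp
  have hKsmooth : ContDiff ℝ ∞ (heatKernel (E := E) t) := by
    have h : heatKernel (E := E) t = fun x =>
        (4 * Real.pi * t) ^ (-(Module.finrank ℝ E : ℝ) / 2) * Real.exp (-(1 / (4 * t)) * ‖x‖ ^ 2) :=
      funext fun x => heatKernel_eq t x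
    rw [h]
    exact contDiff_const.mul (contDiff_const.mul (contDiff_norm_sq ℝ)).exp
  have hksmooth : ContDiff ℝ ∞ k := hKsmooth.comp (contDiff_const.sub contDiff_id)
  have hmp : MeasurePreserving (fun y : E => x - y) volume volume :=
    Measure.measurePreserving_sub_left volume x
  have hk2 : MemLp k 2 volume :=
    (memLp_heatKernel (E := E) ht one_le_two).comp_measurePreserving hmp
  have hDkc : Continuous fun y => fderiv ℝ k y v :=
    (hksmooth.continuous_fderiv (by simp)).clm_apply continuous_const
  have hDk2 : MemLp (fun y => fderiv ℝ k y v) 2 volume := by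
    have h := ((memLp_fderiv_heatKernel_apply (E := E) ht v 2).comp_measurePreserving hmp).neg
    refine (h.congr_norm hDkc.aestronglyMeasurable (Eventually.of_forall fun y => ?_))
    simp only [Pi.neg_apply, Function.comp_apply, hk', norm_neg]
  -- integrability of the two integrands
  have hP : (fun z : E => -(1 / (2 * t)) * ⟪z, v⟫).HasTemperateGrowth := by
    have := ((-(1 / (2 * t))) • innerSL ℝ v : E →L[ℝ] ℝ).hasTemperateGrowth
    convert this using 1
    funext z
    simp [real_inner_comm]
  have i1 : Integrable (fun y => (fderiv ℝ k y v) • φ y) := by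
    have := (integrable_temperate_mul_heatKernel_smul ht hφ2 one_le_two hP x).neg
    refine this.congr (Eventually.of_forall fun y => ?_)
    simp only [hk', fderiv_heatKernel_apply_eq_mul_inner, Pi.neg_apply, neg_smul]
    congr 1
    ring_nf
  have i2 : Integrable (fun y => k y • G y v) := by
    simpa [hk] using integrable_temperate_mul_heatKernel_smul ht hGv one_le_two
      (Function.HasTemperateGrowth.const 1) x
  -- the integrand of `∂ᵥ e^{tΔ}φ` is `-(∂ᵥk) • φ`
  have hlhs : (∫ y, (-(1 / (2 * t)) * ⟪x - y, v⟫ * heatKernel t (x - y)) • φ y) =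
      -∫ y, (fderiv ℝ k y v) • φ y := by
    rw [← integral_neg]
    refine integral_congr_ae (Eventually.of_forall fun y => ?_)
    simp only [hk', fderiv_heatKernel_apply_eq_mul_inner, neg_neg, neg_smul]
    congr 1
    ring
  rw [hlhs]
  -- weak integration by parts, tested against `k • e` for every `e`
  have hsm : ∀ {f : E → ℝ} (_ : Continuous f) (_ : MemLp f 2 volume) (e : F'),
      MemLp (fun y => f y • e) 2 volume := by
    intro f hfc hf e
    refine hf.of_le_mul (c := ‖e‖) (hfc.smul continuous_const).aestronglyMeasurable
      (Eventually.of_forall fun y => ?_)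
    rw [norm_smul, mul_comm]
  have hibp : ∀ e : F', ⟪e, ∫ y, (fderiv ℝ k y v) • φ y⟫ = ⟪e, -∫ y, k y • G y v⟫ := by
    intro e
    have hW : ContDiff ℝ ∞ (fun y => k y • e) := hksmooth.smul contDiff_const
    have hW2 : MemLp (fun y => k y • e) 2 volume := hsm hksmooth.continuous hk2 e
    have hWd : ∀ y, fderiv ℝ (fun y => k y • e) y v = (fderiv ℝ k y v) • e := fun y => by
      rw [fderiv_smul_const (hkd y).differentiableAt]
      simp
    have hDW2 : MemLp (fun y => fderiv ℝ (fun y => k y • e) y v) 2 volume := by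
      simp_rw [hWd]
      exact hsm hDkc hDk2 e
    have h := hG.integral_inner_fderiv_apply_of_memLp hφ2 v hGv hW hW2 hDW2
    simp_rw [hWd, inner_smul_right] at h
    rw [← integral_inner i1, inner_neg_right, ← integral_inner i2]
    simp_rw [inner_smul_right]
    simp_rw [real_inner_comm e] at h
    rw [h]
  have hvec : (∫ y, (fderiv ℝ k y v) • φ y) = -∫ y, k y • G y v := ext_inner_left ℝ hibp
  rw [hvec, neg_neg]

/-- The caloric extension of an `Lᵖ` field is smooth; in particular its derivative field is
continuous. [folklore] -/
theorem continuous_fderiv_heatExtension_of_memLp {F : Type*} [NormedAddCommGroup F]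
    [NormedSpace ℝ F] [CompleteSpace F] {f : E → F} {p : ℝ≥0∞} (hf : MemLp f p volume)
    (hp : 1 ≤ p) {t : ℝ} (ht : 0 < t) : Continuous fun x => fderiv ℝ (heatExtension f t) x :=
  (contDiff_heatExtension_holds hf hp ht).continuous_fderiv (by simp)

/-- **Frobenius `L²` control of the caloric gradients by the data.** For a test field `Φ` and an
`H¹` field `φ` (weak gradient `G`, `∫ |G|² < ∞`) and `0 < t`:
`∫ |D(e^{tΔ}Φ) - D(e^{tΔ}φ)|²_F ≤ ∫ |DΦ - G|²_F` — columnwise, the left-hand field is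
`e^{tΔ}(∂ᵢΦ - G eᵢ)` (derivatives fall on the data, classically for `Φ` and weakly for `φ`), and
`e^{tΔ}` contracts `L²`. [folklore] -/
theorem lintegral_frobeniusNormSq_fderiv_heatExtension_sub_le {Φ φ : E → E} {G : E → E →L[ℝ] E}
    (hΦ : FunctionSpaces.IsTestFunctionOn (⊤ : Opens E) Φ) (hG : HasWeakGradient φ G)
    (hφ2 : MemLp φ 2 volume) (hG2 : ∫⁻ x, ENNReal.ofReal (frobeniusNormSq (G x)) < ⊤)
    {t : ℝ} (ht : 0 < t) :
    ∫⁻ x, ENNReal.ofReal (frobeniusNormSq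
        (fderiv ℝ (heatExtension Φ t) x - fderiv ℝ (heatExtension φ t) x)) ≤
      ∫⁻ x, ENNReal.ofReal (frobeniusNormSq (fderiv ℝ Φ x - G x)) := by
  have hΦ2 : MemLp Φ 2 volume := hΦ.memLp_volume 2
  have hΦi : ∀ v, MemLp (fun y => fderiv ℝ Φ y v) 2 volume := fun v =>
    (hΦ.fderiv_apply_const v).memLp_volume 2
  have hGi : ∀ i, MemLp (fun y => G y (stdOrthonormalBasis ℝ E i)) 2 volume := fun i =>
    hG.memLp_apply hG2 i
  -- measurability of the two matrix fields
  have hA : AEStronglyMeasurable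
      (fun x => fderiv ℝ (heatExtension Φ t) x - fderiv ℝ (heatExtension φ t) x) volume :=
    ((continuous_fderiv_heatExtension_of_memLp hΦ2 one_le_two ht).sub
      (continuous_fderiv_heatExtension_of_memLp hφ2 one_le_two ht)).aestronglyMeasurable
  have hB : AEStronglyMeasurable (fun x => fderiv ℝ Φ x - G x) volume :=
    (hΦ.contDiff.continuous_fderiv (by simp)).aestronglyMeasurable.sub hG.aestronglyMeasurable_deriv
  rw [lintegral_ofReal_frobeniusNormSq_eq_sum hA, lintegral_ofReal_frobeniusNormSq_eq_sum hB]
  refine Finset.sum_le_sum fun i _ => ?_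
  -- the `i`-th column is the caloric extension of `∂ᵢΦ - G eᵢ`
  set h : E → E := (fun y => fderiv ℝ Φ y (stdOrthonormalBasis ℝ E i)) -
    fun y => G y (stdOrthonormalBasis ℝ E i) with hh
  have hcol : ∀ x, (fderiv ℝ (heatExtension Φ t) x - fderiv ℝ (heatExtension φ t) x)
      (stdOrthonormalBasis ℝ E i) = heatExtension h t x := by
    intro x
    rw [sub_apply, hh, heatExtension_sub_of_memLp (hΦi _) (hGi i) one_le_two ht,
      fderiv_heatExtension_apply_eq_heatExtension_fderiv (hΦ.contDiff.of_le (by simp)) hΦ2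
        one_le_two (hΦi _) one_le_two ht,
      hG.fderiv_heatExtension_apply hφ2 _ (hGi i) ht]
  have hcol' : ∀ x, (fderiv ℝ Φ x - G x) (stdOrthonormalBasis ℝ E i) = h x := fun x => by
    rw [sub_apply, hh, Pi.sub_apply]
  calc ∫⁻ x, ‖(fderiv ℝ (heatExtension Φ t) x - fderiv ℝ (heatExtension φ t) x)
          (stdOrthonormalBasis ℝ E i)‖ₑ ^ (2 : ℝ)
      = ∫⁻ x, ‖heatExtension h t x‖ₑ ^ 2 :=
        lintegral_congr fun x => by rw [ENNReal.rpow_two, hcol x]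
    _ = eLpNorm (heatExtension h t) 2 volume ^ 2 := (eLpNorm_two_sq_eq_lintegral _ _).symm
    _ ≤ eLpNorm h 2 volume ^ 2 := by
        gcongr
        exact eLpNorm_heatExtension_le_holds ((hΦi _).sub (hGi i)) one_le_two ht
    _ = ∫⁻ x, ‖h x‖ₑ ^ 2 := eLpNorm_two_sq_eq_lintegral _ _
    _ = ∫⁻ x, ‖(fderiv ℝ Φ x - G x) (stdOrthonormalBasis ℝ E i)‖ₑ ^ (2 : ℝ) :=
        lintegral_congr fun x => by rw [ENNReal.rpow_two, hcol' x]

end HeatWeak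

/-! ### Joint continuity of the caloric gradient of a test field -/

section Caloric

/-- For a test field `Φ`, the gradient of the caloric test field,
`(σ, x) ↦ D(e^{νσΔ}Φ)(x) = e^{νσΔ}(DΦ)(x)`, is jointly continuous on `ℝ × E` (derivatives fall on
the data, and the heat flow of a bounded continuous field is jointly continuous). [folklore] -/
theorem continuous_uncurry_fderiv_heatTest {Φ : E → E}
    (hΦ : FunctionSpaces.IsTestFunctionOn (⊤ : Opens E) Φ) (ν : ℝ) :
    Continuous fun q : ℝ × E => fderiv ℝ (heatTest ν Φ q.1) q.2 := by
  refine continuous_clm_apply.2 fun v => ?_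
  have hg : Continuous fun y => fderiv ℝ Φ y v := (hΦ.fderiv_apply_const v).contDiff.continuous
  obtain ⟨C, hC⟩ := hg.bounded_above_of_compact_support (hΦ.fderiv_apply_const v).hasCompactSupport
  have h := (continuous_uncurry_heatFlow hg hC).comp
    ((continuous_const.mul continuous_fst).prodMk continuous_snd : Continuous
      fun q : ℝ × E => (ν * q.1, q.2))
  refine h.congr fun q => ?_
  simp only [Function.comp_apply, Function.uncurry_apply_pair, fderiv_heatTest_apply hΦ]
  rfl

end Caloric

/-! ### The duality (mild) identity for `H¹_σ` test fields -/

section Main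

variable {T ν : ℝ} {u₀ : E → E} {u : ℝ → E → E}

/-- **Leray–Hopf weak solutions satisfy the duality (mild) identity against every `H¹_σ` field.**
Let `dim E = 3`, `0 < ν`, `u₀ ∈ L²`, `u` a Leray–Hopf weak solution of the unforced
Navier–Stokes system on `E × [0, T)` with datum `u₀`, and `φ ∈ L²(E; E)` weakly divergence free
with a weak gradient `G`, `∫ |G|² < ∞` (i.e. `φ ∈ H¹_σ`). Then for every `t ∈ (0, T]`,
`⟨u(t), φ⟩ = ⟨u₀, e^{νtΔ}φ⟩ + ∫_{(0,t]} ⟨u(τ), (u(τ)·∇) e^{ν(t-τ)Δ}φ⟩ dτ`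
(Fabes–Jones–Rivière 1972, Thm. 2.1; Lemarié-Rieusset 2016, Prop. 6.5 — there for all
divergence-free tests with enough decay). Proof: the tree's identity for `φ ∈ C_{c,σ}^∞`
(`IsLerayHopfOn.integral_inner_eq_mild`) applied to divergence-free test fields `Φₙ → φ` in `H¹`
(`exists_isDivFree_test_approx`, density of `C_{c,σ}^∞` in `H¹_σ`), and passage to the limit:
the two linear terms by `L²` contraction of the heat flow, the nonlinear term because
`D(e^{sΔ}Φₙ) - D(e^{sΔ}φ) = e^{sΔ}(DΦₙ - G)` is bounded in Frobenius `L²` by `‖DΦₙ - G‖₂`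
(`lintegral_frobeniusNormSq_fderiv_heatExtension_sub_le`) and `∫₀ᵀ ‖u‖₄² < ∞`
(`IsLerayHopfOn.lintegral_eLpNorm_four_sq_lt_top`). [cite: FabesJonesRiviere1972, Thm. 2.1] -/
theorem IsLerayHopfOn.integral_inner_eq_mild_of_hasWeakGradient (hE3 : Module.finrank ℝ E = 3)
    (hu : IsLerayHopfOn T ν 0 u₀ u) (hu₀ : MemLp u₀ 2 volume) (hν : 0 < ν) (hT : 0 < T)
    {φ : E → E} {Gφ : E → E →L[ℝ] E} (hφ2 : MemLp φ 2 volume) (hdiv : IsWeaklyDivFree φ)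
    (hφG : HasWeakGradient φ Gφ) (hG2 : ∫⁻ x, ENNReal.ofReal (frobeniusNormSq (Gφ x)) < ⊤)
    {t : ℝ} (ht : t ∈ Ioc 0 T) :
    ∫ x, ⟪u t x, φ x⟫ = (∫ x, ⟪u₀ x, heatTest ν φ t x⟫) +
      ∫ τ in Ioc 0 t, ∫ x, ⟪u τ x, convect (u τ) (heatTest ν φ (t - τ)) x⟫ := by
  haveI : ENNReal.HolderTriple 4 4 2 := holderTriple_four_four_two
  have htT : t ≤ T := ht.2
  have ht0 : 0 < t := ht.1
  have hL2 : ∀ s ∈ Icc 0 T, MemLp (u s) 2 volume := hu.memLp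
  -- ### the approximating divergence-free test fields
  set δ : ℕ → ℝ≥0∞ := fun n => ENNReal.ofReal (1 / ((n : ℝ) + 1)) with hδ
  have hδpos : ∀ n, 0 < δ n := fun n => ENNReal.ofReal_pos.2 (by positivity)
  have hδ0 : Tendsto δ atTop (𝓝 0) := by
    have h := ENNReal.tendsto_ofReal (tendsto_one_div_add_atTop_nhds_zero_nat)
    rwa [ENNReal.ofReal_zero] at h
  have hex : ∀ n : ℕ, ∃ Φ : E → E, FunctionSpaces.IsTestFunctionOn (⊤ : Opens E) Φ ∧
      VectorCalculus.IsDivFree Φ ∧ eLpNorm (Φ - φ) 2 volume ≤ δ n ∧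
      ∫⁻ x, ENNReal.ofReal (frobeniusNormSq (fderiv ℝ Φ x - Gφ x)) ≤ δ n := fun n =>
    exists_isDivFree_test_approx hE3 hφ2 hdiv hφG hG2 (hδpos n)
  choose Φ hΦt hΦdiv hΦL2 hΦD using hex
  have hΦ2 : ∀ n, MemLp (Φ n) 2 volume := fun n => (hΦt n).memLp_volume 2
  -- the identity for each `Φ n`, with the time integral over `Ioo 0 t`
  set c : ℕ → ℝ → ℝ := fun n τ =>
    ∫ x, ⟪u τ x, convect (u τ) (heatTest ν (Φ n) (t - τ)) x⟫ with hc
  set cφ : ℝ → ℝ := fun τ => ∫ x, ⟪u τ x, convect (u τ) (heatTest ν φ (t - τ)) x⟫ with hcφ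
  have hI : ∀ n, ∫ x, ⟪u t x, Φ n x⟫ = (∫ x, ⟪u₀ x, heatTest ν (Φ n) t x⟫) +
      ∫ τ in Ioo 0 t, c n τ := fun n => by
    rw [← integral_Ioc_eq_integral_Ioo]
    exact hu.integral_inner_eq_mild hE3 hu₀ hν hT (hΦt n) (hΦdiv n) ht
  -- ### (a) the pairing at time `t`
  have hlimL : Tendsto (fun n => ∫ x, ⟪u t x, Φ n x⟫) atTop (𝓝 (∫ x, ⟪u t x, φ x⟫)) := by
    have hut : MemLp (u t) 2 volume := hL2 t ⟨ht0.le, htT⟩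
    refine tendsto_of_enorm_sub_le (e := fun n => eLpNorm (u t) 2 volume * δ n) (fun n => ?_) ?_
    · have hsub : (∫ x, ⟪u t x, Φ n x⟫) - ∫ x, ⟪u t x, φ x⟫ = ∫ x, ⟪u t x, Φ n x - φ x⟫ := by
        rw [← integral_sub (FunctionSpaces.integrable_inner_of_eLpNorm_two_lt_top hut.1 (hΦ2 n).1
          hut.2 (hΦ2 n).2) (FunctionSpaces.integrable_inner_of_eLpNorm_two_lt_top hut.1 hφ2.1
          hut.2 hφ2.2)]
        exact integral_congr_ae (Eventually.of_forall fun x => (inner_sub_right _ _ _).symm)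
      rw [hsub]
      exact (FunctionSpaces.enorm_integral_inner_le_eLpNorm_mul hut.1 ((hΦ2 n).1.sub hφ2.1)).trans
        (mul_le_mul' le_rfl (hΦL2 n))
    · have h := ENNReal.Tendsto.const_mul hδ0 (Or.inr hut.eLpNorm_ne_top)
      rwa [mul_zero] at h
  -- ### (b) the free term
  have hlimA : Tendsto (fun n => ∫ x, ⟪u₀ x, heatTest ν (Φ n) t x⟫) atTop
      (𝓝 (∫ x, ⟪u₀ x, heatTest ν φ t x⟫)) := by
    have hνt : 0 < ν * t := mul_pos hν ht0
    have hH : ∀ {f : E → E}, MemLp f 2 volume → MemLp (heatTest ν f t) 2 volume := fun hf => by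
      rw [heatTest_of_pos hν ht0]
      exact memLp_heatExtension_holds hf one_le_two hνt
    refine tendsto_of_enorm_sub_le (e := fun n => eLpNorm u₀ 2 volume * δ n) (fun n => ?_) ?_
    · have hsub : (∫ x, ⟪u₀ x, heatTest ν (Φ n) t x⟫) - ∫ x, ⟪u₀ x, heatTest ν φ t x⟫ =
          ∫ x, ⟪u₀ x, heatTest ν (Φ n - φ) t x⟫ := by
        rw [← integral_sub (FunctionSpaces.integrable_inner_of_eLpNorm_two_lt_top hu₀.1 (hH (hΦ2 n)).1
          hu₀.2 (hH (hΦ2 n)).2) (FunctionSpaces.integrable_inner_of_eLpNorm_two_lt_top hu₀.1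
          (hH hφ2).1 hu₀.2 (hH hφ2).2)]
        refine integral_congr_ae (Eventually.of_forall fun x => ?_)
        dsimp only
        rw [← inner_sub_right, heatTest_of_pos hν ht0, heatTest_of_pos hν ht0, heatTest_of_pos hν ht0,
          heatExtension_sub_of_memLp (hΦ2 n) hφ2 one_le_two hνt]
      rw [hsub]
      refine (FunctionSpaces.enorm_integral_inner_le_eLpNorm_mul hu₀.1 (hH ((hΦ2 n).sub hφ2)).1).trans ?_
      refine mul_le_mul' le_rfl (le_trans ?_ (hΦL2 n))
      rw [heatTest_of_pos hν ht0]
      exact eLpNorm_heatExtension_le_holds ((hΦ2 n).sub hφ2) one_le_two hνt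
    · have h := ENNReal.Tendsto.const_mul hδ0 (Or.inr hu₀.eLpNorm_ne_top)
      rwa [mul_zero] at h
  -- ### (c) the nonlinear term
  have hlimC : Tendsto (fun n => ∫ τ in Ioo 0 t, c n τ) atTop (𝓝 (∫ τ in Ioo 0 t, cφ τ)) := by
    -- a jointly measurable weak-gradient witness, for the `L⁴` integrability of the slices
    obtain ⟨G, hG, hG₂, -, -⟩ := hu.weakGrad_energy
    obtain ⟨Gu, hGum, hGuae⟩ := exists_stronglyMeasurable_weakGradient hu.weak.1 hG
    have hGu : ∀ᵐ τ ∂(volume.restrict (Ioo 0 T)), HasWeakGradient (u τ) (Gu τ) := by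
      filter_upwards [hG, hGuae] with τ h1 h2
      exact h1.congr_grad_ae h2
    have hGu₂ : ∫⁻ τ in Ioo 0 T, ∫⁻ x, ENNReal.ofReal (frobeniusNormSq (Gu τ x)) < ⊤ := by
      have hDeq : ∀ᵐ τ ∂(volume.restrict (Ioo 0 T)),
          ∫⁻ x, ENNReal.ofReal (frobeniusNormSq (Gu τ x)) =
            ∫⁻ x, ENNReal.ofReal (frobeniusNormSq (G τ x)) := by
        filter_upwards [hGuae] with τ hτ
        exact lintegral_congr_ae (by filter_upwards [hτ] with x hx; rw [hx])
      rw [lintegral_congr_ae hDeq]; exact hG₂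
    -- the weight `W τ = ‖u τ‖₄²`, integrable on `(0, T)`
    set W : ℝ → ℝ≥0∞ := fun τ => eLpNorm (u τ) 4 volume ^ (2 : ℝ) with hW
    have hIW : ∫⁻ τ in Ioo 0 T, W τ < ⊤ := hu.lintegral_eLpNorm_four_sq_lt_top hE3 hGum hGu hGu₂
    have hWm : AEMeasurable W (volume.restrict (Ioo 0 T)) :=
      (FunctionSpaces.aemeasurable_eLpNorm_slice hu.aestronglyMeasurable_uncurry 4).pow_const _
    set μt : Measure ℝ := volume.restrict (Ioo 0 t) with hμt
    have hsubT : Ioo 0 t ⊆ Ioo 0 T := Ioo_subset_Ioo le_rfl htT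
    have hμle : μt ≤ volume.restrict (Ioo 0 T) := Measure.restrict_mono hsubT le_rfl
    have hIWt : ∫⁻ τ, W τ ∂μt < ⊤ := lt_of_le_of_lt (lintegral_mono' hμle le_rfl) hIW
    have hWmt : AEMeasurable W μt := hWm.mono_measure hμle
    have hWfin : ∀ᵐ τ ∂μt, W τ < ⊤ := ae_lt_top' hWmt hIWt.ne
    have hmemt : ∀ᵐ τ ∂μt, τ ∈ Ioo 0 t := ae_restrict_mem measurableSet_Ioo
    -- the caloric gradient fields
    set A : ℕ → ℝ → E → E →L[ℝ] E := fun n τ x => fderiv ℝ (heatTest ν (Φ n) (t - τ)) x with hA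
    set Aφ : ℝ → E → E →L[ℝ] E := fun τ x => fderiv ℝ (heatTest ν φ (t - τ)) x with hAφ
    have hAc : ∀ n, Continuous fun q : ℝ × E => A n q.1 q.2 := fun n =>
      (continuous_uncurry_fderiv_heatTest (hΦt n) ν).comp
        ((continuous_const.sub continuous_fst).prodMk continuous_snd)
    have hAeq : ∀ n τ, τ < t → A n τ = fun x => fderiv ℝ (heatExtension (Φ n) (ν * (t - τ))) x :=
      fun n τ hτ => funext fun x => by simp only [hA, heatTest_of_pos hν (sub_pos.2 hτ)]
    have hAφeq : ∀ τ, τ < t → Aφ τ = fun x => fderiv ℝ (heatExtension φ (ν * (t - τ))) x :=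
      fun τ hτ => funext fun x => by simp only [hAφ, heatTest_of_pos hν (sub_pos.2 hτ)]
    have hAφm : ∀ τ, τ < t → AEStronglyMeasurable (Aφ τ) volume := fun τ hτ => by
      rw [hAφeq τ hτ]
      exact (continuous_fderiv_heatExtension_of_memLp hφ2 one_le_two
        (mul_pos hν (sub_pos.2 hτ))).aestronglyMeasurable
    -- Frobenius bounds: `∫|Aφ|² ≤ ∫|Gφ|²` and `∫|A n - Aφ|² ≤ δ n`
    have hAφD : ∀ τ, τ < t → ∫⁻ x, ENNReal.ofReal (frobeniusNormSq (Aφ τ x)) ≤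
        ∫⁻ x, ENNReal.ofReal (frobeniusNormSq (Gφ x)) := by
      intro τ hτ
      have h := lintegral_frobeniusNormSq_fderiv_heatExtension_sub_le
        (FunctionSpaces.isTestFunctionOn_zero (⊤ : Opens E)) hφG hφ2 hG2 (mul_pos hν (sub_pos.2 hτ))
      have h0 : ∀ r : ℝ, heatExtension (0 : E → E) r = 0 := fun r => by
        funext x; simp [heatExtension_apply]
      simp only [h0, fderiv_zero, Pi.zero_apply, zero_sub] at h
      have hneg : ∀ L : E →L[ℝ] E, frobeniusNormSq (-L) = frobeniusNormSq L := fun L => by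
        rw [← zero_sub, frobeniusNormSq_sub_comm, sub_zero]
      rw [hAφeq τ hτ]
      simpa only [hneg] using h
    have hAD : ∀ n τ, τ < t → ∫⁻ x, ENNReal.ofReal (frobeniusNormSq (A n τ x - Aφ τ x)) ≤ δ n := by
      intro n τ hτ
      rw [hAeq n τ hτ, hAφeq τ hτ]
      exact (lintegral_frobeniusNormSq_fderiv_heatExtension_sub_le (hΦt n) hφG hφ2 hG2
        (mul_pos hν (sub_pos.2 hτ))).trans (hΦD n)
    -- measurability of `c n` on `(0, t)`
    have hum : AEStronglyMeasurable (uncurry u) (μt.prod volume) :=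
      hu.aestronglyMeasurable_uncurry.mono_measure (Measure.prod_mono hμle le_rfl)
    have hcm : ∀ n, AEStronglyMeasurable (c n) μt := by
      intro n
      have hm : AEStronglyMeasurable
          (fun q : ℝ × E => ⟪uncurry u q, A n q.1 q.2 (uncurry u q)⟫) (μt.prod volume) :=
        hum.inner (isBoundedBilinearMap_apply.continuous.comp_aestronglyMeasurable
          ((hAc n).aestronglyMeasurable.prodMk hum))
      exact hm.integral_prod_right'
    -- pointwise bounds at good times
    set CG : ℝ≥0∞ := (∫⁻ x, ENNReal.ofReal (frobeniusNormSq (Gφ x))) ^ (1 / 2 : ℝ) with hCG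
    have hCGtop : CG ≠ ⊤ := ENNReal.rpow_ne_top_of_nonneg (by norm_num) hG2.ne
    have hgood : ∀ᵐ τ ∂μt, (∀ n, ‖c n τ - cφ τ‖ₑ ≤ δ n ^ (1 / 2 : ℝ) * W τ) ∧
        ‖cφ τ‖ₑ ≤ CG * W τ ∧ W τ < ⊤ := by
      filter_upwards [hWfin, hmemt] with τ hWτ hτ
      have h4τ : eLpNorm (u τ) 4 volume < ⊤ := by
        have : eLpNorm (u τ) 4 volume ^ (2 : ℝ) < ⊤ := hWτ
        exact (ENNReal.rpow_lt_top_iff_of_pos zero_lt_two).1 this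
      have hmem4 : MemLp (u τ) 4 volume := ⟨(hL2 τ ⟨hτ.1.le, hτ.2.le.trans htT⟩).1, h4τ⟩
      have hWeq : W τ = eLpNorm (u τ) 4 volume * eLpNorm (u τ) 4 volume := by
        simp only [hW]
        rw [ENNReal.rpow_two, sq]
      have hAφ2 : ∫⁻ x, ENNReal.ofReal (frobeniusNormSq (Aφ τ x)) < ⊤ :=
        (hAφD τ hτ.2).trans_lt hG2
      have hA12 : ∀ n, ∫⁻ x, ENNReal.ofReal (frobeniusNormSq (A n τ x - Aφ τ x)) < ⊤ := fun n =>
        (hAD n τ hτ.2).trans_lt ENNReal.ofReal_lt_top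
      have hAnm : ∀ n, AEStronglyMeasurable (A n τ) volume := fun n =>
        ((hAc n).comp (Continuous.prodMk_right τ)).aestronglyMeasurable
      have hA12m : ∀ n, AEStronglyMeasurable (fun x => A n τ x - Aφ τ x) volume := fun n =>
        (hAnm n).sub (hAφm τ hτ.2)
      -- integrability of the two pieces of `c n τ`
      have iφ : Integrable (fun x => ⟪u τ x, Aφ τ x (u τ x)⟫) :=
        (integrable_inner_apply_of_holder (hAφm τ hτ.2) hAφ2 hmem4 hmem4).congr
          (ae_of_all _ fun x => real_inner_comm _ _)
      have i12 : ∀ n, Integrable (fun x => ⟪u τ x, (A n τ x - Aφ τ x) (u τ x)⟫) := fun n =>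
        (integrable_inner_apply_of_holder (hA12m n) (hA12 n) hmem4 hmem4).congr
          (ae_of_all _ fun x => real_inner_comm _ _)
      have hcn : ∀ n, c n τ - cφ τ = ∫ x, ⟪u τ x, (A n τ x - Aφ τ x) (u τ x)⟫ := by
        intro n
        have h1 : c n τ = (∫ x, ⟪u τ x, (A n τ x - Aφ τ x) (u τ x)⟫) + cφ τ := by
          simp only [hc, hcφ, convect_apply]
          rw [← integral_add (i12 n) iφ]
          refine integral_congr_ae (ae_of_all _ fun x => ?_)
          dsimp only
          rw [← inner_add_right, sub_apply, sub_add_cancel]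
        rw [h1, add_sub_cancel_right]
      refine ⟨fun n => ?_, ?_, hWτ⟩
      · rw [hcn n]
        refine (enorm_integral_le_lintegral_enorm _).trans ?_
        calc ∫⁻ x, ‖⟪u τ x, (A n τ x - Aφ τ x) (u τ x)⟫‖ₑ
            = ∫⁻ x, ‖⟪(A n τ x - Aφ τ x) (u τ x), u τ x⟫‖ₑ :=
              lintegral_congr fun x => by rw [real_inner_comm]
          _ ≤ (∫⁻ x, ENNReal.ofReal (frobeniusNormSq (A n τ x - Aφ τ x))) ^ (1 / 2 : ℝ) *
                (eLpNorm (u τ) 4 volume * eLpNorm (u τ) 4 volume) :=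
              lintegral_enorm_inner_apply_le (hA12m n) hmem4.1 hmem4.1 4 4
          _ ≤ δ n ^ (1 / 2 : ℝ) * W τ := by
              rw [hWeq]
              gcongr
              exact hAD n τ hτ.2
      · simp only [hcφ, convect_apply]
        refine (enorm_integral_le_lintegral_enorm _).trans ?_
        calc ∫⁻ x, ‖⟪u τ x, Aφ τ x (u τ x)⟫‖ₑ
            = ∫⁻ x, ‖⟪Aφ τ x (u τ x), u τ x⟫‖ₑ := lintegral_congr fun x => by rw [real_inner_comm]
          _ ≤ (∫⁻ x, ENNReal.ofReal (frobeniusNormSq (Aφ τ x))) ^ (1 / 2 : ℝ) *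
                (eLpNorm (u τ) 4 volume * eLpNorm (u τ) 4 volume) :=
              lintegral_enorm_inner_apply_le (hAφm τ hτ.2) hmem4.1 hmem4.1 4 4
          _ ≤ CG * W τ := by
              rw [hWeq, hCG]
              exact mul_le_mul' (ENNReal.rpow_le_rpow (hAφD τ hτ.2) (by norm_num)) le_rfl
    -- pointwise convergence, measurability and integrability of the limit
    have hδhalf : Tendsto (fun n => δ n ^ (1 / 2 : ℝ)) atTop (𝓝 0) := by
      have h := hδ0.ennrpow_const (1 / 2 : ℝ)
      rwa [ENNReal.zero_rpow_of_pos (by norm_num)] at h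
    have hptw : ∀ᵐ τ ∂μt, Tendsto (fun n => c n τ) atTop (𝓝 (cφ τ)) := by
      filter_upwards [hgood] with τ hτ
      refine tendsto_of_enorm_sub_le (e := fun n => δ n ^ (1 / 2 : ℝ) * W τ) hτ.1 ?_
      have h := ENNReal.Tendsto.mul_const hδhalf (Or.inr hτ.2.2.ne)
      rwa [zero_mul] at h
    have hcφm : AEStronglyMeasurable cφ μt := aestronglyMeasurable_of_tendsto_ae atTop hcm hptw
    have hcφi : Integrable cφ μt := by
      refine ⟨hcφm, ?_⟩
      calc ∫⁻ τ, ‖cφ τ‖ₑ ∂μt ≤ ∫⁻ τ, CG * W τ ∂μt :=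
            lintegral_mono_ae (hgood.mono fun τ hτ => hτ.2.1)
        _ = CG * ∫⁻ τ, W τ ∂μt := lintegral_const_mul'' _ hWmt
        _ < ⊤ := ENNReal.mul_lt_top hCGtop.lt_top hIWt
    have hci : ∀ n, Integrable (c n) μt := by
      intro n
      refine ⟨hcm n, ?_⟩
      have hle : ∀ᵐ τ ∂μt, ‖c n τ‖ₑ ≤ (δ n ^ (1 / 2 : ℝ) + CG) * W τ := by
        filter_upwards [hgood] with τ hτ
        calc ‖c n τ‖ₑ = ‖(c n τ - cφ τ) + cφ τ‖ₑ := by rw [sub_add_cancel]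
          _ ≤ ‖c n τ - cφ τ‖ₑ + ‖cφ τ‖ₑ := enorm_add_le _ _
          _ ≤ δ n ^ (1 / 2 : ℝ) * W τ + CG * W τ := add_le_add (hτ.1 n) hτ.2.1
          _ = (δ n ^ (1 / 2 : ℝ) + CG) * W τ := by rw [add_mul]
      calc ∫⁻ τ, ‖c n τ‖ₑ ∂μt ≤ ∫⁻ τ, (δ n ^ (1 / 2 : ℝ) + CG) * W τ ∂μt := lintegral_mono_ae hle
        _ = (δ n ^ (1 / 2 : ℝ) + CG) * ∫⁻ τ, W τ ∂μt := lintegral_const_mul'' _ hWmt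
        _ < ⊤ := ENNReal.mul_lt_top (ENNReal.add_lt_top.2
            ⟨ENNReal.rpow_lt_top_of_nonneg (by norm_num) ENNReal.ofReal_ne_top, hCGtop.lt_top⟩) hIWt
    -- convergence of the time integrals
    refine tendsto_of_enorm_sub_le (e := fun n => δ n ^ (1 / 2 : ℝ) * ∫⁻ τ, W τ ∂μt)
      (fun n => ?_) ?_
    · rw [← integral_sub (hci n) hcφi]
      refine (enorm_integral_le_lintegral_enorm _).trans ?_
      calc ∫⁻ τ, ‖c n τ - cφ τ‖ₑ ∂μt ≤ ∫⁻ τ, δ n ^ (1 / 2 : ℝ) * W τ ∂μt :=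
            lintegral_mono_ae (hgood.mono fun τ hτ => hτ.1 n)
        _ = δ n ^ (1 / 2 : ℝ) * ∫⁻ τ, W τ ∂μt := lintegral_const_mul'' _ hWmt
    · have h := ENNReal.Tendsto.mul_const hδhalf (Or.inr hIWt.ne)
      rwa [zero_mul] at h
  -- ### conclusion
  have hsum : Tendsto (fun n => (∫ x, ⟪u₀ x, heatTest ν (Φ n) t x⟫) + ∫ τ in Ioo 0 t, c n τ) atTop
      (𝓝 (∫ x, ⟪u t x, φ x⟫)) := hlimL.congr hI
  have := tendsto_nhds_unique hsum (hlimA.add hlimC)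
  rw [this, ← integral_Ioc_eq_integral_Ioo]

end Main

end Literature.Analysis.FluidPDE

end
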